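import Literature.MathematicalPhysics.QuantumFieldTheory.YangMillsOS
import HarnessLib

/-!
# QuantumFields / YangMills — sub-problem statement draft (D-0018(2): Clay verbatim, every `G`)

Target path: `lean/Summits/QuantumFields/YangMills/Statement.lean`.
Imports the draft Literature interface files `QuantumFieldTheory/OSData.lean` (`OSData ι d`: OS
axioms E0, E0', E1–E4 as fields; full-spectrum `HasMassGap`; `IsNontrivial`, `IsNonGaussian`) and
`QuantumFieldTheory/YangMillsOS.lean` (`IsCompactSimpleLieGroup`, `LatticeRep`, `YMSpecies`,
`SpeciesScheme`, `IsYangMillsFor`, `HasLatticeMassGap`), which must land in the tree first.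

## Source (binding, verbatim): Jaffe–Witten, *Quantum Yang–Mills theory* (Clay 2000), §4

> Since the vacuum vector `Ω` is Poincaré invariant, it is an eigenstate with zero energy, namely
> `HΩ = 0`. The positive energy axiom asserts that in any quantum field theory, the spectrum of
> `H` is supported in the region `[0, ∞)`. A quantum field theory has a mass gap `Δ` if `H` has no
> spectrum in the interval `(0, Δ)` for some `Δ > 0`. The supremum of such `Δ` is the mass `m`,
> and we require `m < ∞`.
> **Yang–Mills Existence and Mass Gap.** Prove that for any compact simple gauge group `G`, a
> non-trivial quantum Yang–Mills theory exists on `ℝ⁴` and has a mass gap `Δ > 0`. Existence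
> includes establishing axiomatic properties at least as strong as those cited in [45, 35].

[45] Streater–Wightman 1964; [35] Osterwalder–Schrader, CMP 31 (1973), 42 (1975).

## Rendering (clause by clause; human ruling D-0018(2) fixes: ∀ compact simple `G`; FULL spectrum)

* "for any compact simple gauge group `G`": `∀ (G : Type) [Group G] [TopologicalSpace G]
  [IsTopologicalGroup G] [CompactSpace G], IsCompactSimpleLieGroup G →` — compact topological
  group, simple in the compact-Lie sense (tree `IsSimpleCompactGroup`) and admitting a faithful
  continuous unitary matrix representation (⇔ Lie); the Borel σ-algebra is supplied inside.
* "a quantum … theory exists on `ℝ⁴` … [45, 35]": `∃ T : OSData (YMSpecies G) 4` — joint Schwinger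
  functions on `ℝ⁴` of one hermitian scalar field per gauge-invariant local lattice observable of
  `G` (ALL of them), with E0, E0', E1–E4 as fields; OS reconstruction [35, II, Thm. E→R] yields
  the Wightman theory of [45] on the Hilbert space `ℋ_T` these fields generate.
* "Yang–Mills theory [with gauge group `G`]": `∃ (r : LatticeRep G) (sch : SpeciesScheme _)`,
  `sch.HasWeakCouplingLimit ∧ IsYangMillsFor r sch T` — every species string's Schwinger functions
  are the limits on `⁰𝒮`, along a SEQUENCE of spacings `a_k → 0` with `a_k L_k → ∞` (human ruling
  2026-08-15, Y2: existence, not uniqueness, of the continuum limit), of the renormalised lattice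
  correlations under Wilson's action `β_k ∑ₚ Re tr r.ρ(U_p)` (Jaffe–Witten §6; the faithful
  representation `r` is the "Tr" of their Lagrangian (1), chosen by the prover as part of the
  regularisation), taken at WEAK COUPLING `β_k = 2/g₀(a_k)² → ∞` (statement re-type 2026-08-16,
  semantic-vacuity audit §2.4-D / §4 item 4: before it, `β` was idle witness data and a
  hypothetical finite-`β` critical point of the lattice theory would have qualified; the minimal
  `G`-independent form of asymptotic freedom — the two-loop profile is recorded in `YangMillsOS`
  as the strengthening pending Lie-algebra data `b₀(G, r)`). Interface predicates.
* "non-trivial" (and "`m < ∞`"): on the curvature species `r.curvature` (`tr F_{μν}F_{μν}`):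
  `IsNontrivial` (not a c-number) and `IsNonGaussian` (not a generalised free field).
* "has a mass gap `Δ > 0`" for the FULL Hamiltonian: `∃ Δ > 0, T.HasMassGap Δ ∧ HasLatticeMassGap
  r sch Δ` — clustering at rate `Δ` of ALL species strings (`σ(H) ∩ (0, Δ) = ∅`, `Ω` unique, on all
  of `ℋ_T`), and, so that no choice of renormalisations can shrink the family, the same bound for
  ALL pairs of gauge-invariant lattice observables uniformly along the sequence and in the volume
  (the lattice Hamiltonians have no spectrum in `(0, Δ)`; Jaffe–Witten §1 (1), §5).
-/

open Literature.MathematicalPhysics.QuantumFieldTheory Literature.MathematicalPhysics.QuantumLattice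

/-- **Yang–Mills existence and mass gap** (Jaffe–Witten 2000, §4, verbatim: "Prove that for any
compact simple gauge group `G`, a non-trivial quantum Yang–Mills theory exists on `ℝ⁴` and has a
mass gap `Δ > 0`. Existence includes establishing axiomatic properties at least as strong as
those cited in [45, 35]."): for every compact simple Lie group `G` there are a faithful unitary
lattice representation `r`, a sequential weak-coupling scaling scheme (`a_k → 0`,
`β_k = 2/g₀² → ∞`: `SpeciesScheme.HasWeakCouplingLimit`, re-type 2026-08-16), and
Osterwalder–Schrader data `T` on `ℝ⁴` for ALL
gauge-invariant local observables of `G`-gauge theory (axioms E0, E0', E1–E4) which ARE quantum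
Yang–Mills theory with gauge group `G` (`IsYangMillsFor`: joint continuum limit of Wilson's
lattice theory along the sequence), non-trivial and non-Gaussian in the curvature field `tr F²`, with a mass gap
`Δ > 0` of the full Hamiltonian: `H` has no spectrum in `(0, Δ)` on the whole reconstructed
Hilbert space (`HasMassGap`, all species) and on the lattice Hilbert spaces uniformly in the
spacing and the volume (`HasLatticeMassGap`). Open problem: a `Prop`, never asserted. [problem: constructive-qft]
[cite: JaffeWitten2000, §4] -/
def YangMills : Prop :=
  ∀ (G : Type) [Group G] [TopologicalSpace G] [IsTopologicalGroup G] [CompactSpace G],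
    IsCompactSimpleLieGroup G →
      letI : MeasurableSpace G := borel G
      haveI : BorelSpace G := ⟨rfl⟩
      ∃ (r : LatticeRep G) (sch : SpeciesScheme (YMSpecies G)) (T : OSData (YMSpecies G) 4),
        sch.HasWeakCouplingLimit ∧ IsYangMillsFor r sch T ∧ T.IsNontrivial r.curvature ∧
          T.IsNonGaussian r.curvature ∧ ∃ Δ > 0, T.HasMassGap Δ ∧ HasLatticeMassGap r sch Δ
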